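import Mathlib
import Summits.NavierStokesRegularity.NavierStokesRegularity.Theorems.FilamentSkeletonRssStadiumKernelPieces

/-!
# Route `FilamentSkeletonRss` · child crux `TangentSkeletonNearStraightL` (stmt-NavierStokesRegularity-23320) · registered line
# `child_tangent_analytic_strip_L` (b0b56c52900dd90a), stub `stub_stripPropagation` — brick: THE KERNEL IS HOLOMORPHIC IN THE SOURCE VARIABLE

Fourth assembly step of R7 (STUB-PLAN memo attached to 23320): moving between source contours (`Theorems.StadiumShiftedContour`, the rectangle Cauchy
theorem) requires the complexified matched integrand to be holomorphic in the SOURCE point `ζ` for a fixed target `z`: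
`ζ ↦ ((Σᵢ(Fᵢ(z) − Fᵢ(ζ))² + κ·G(ζ))^{3/2})⁻¹ • (F′(ζ) ⨯₃ (F(z) − F(ζ)))` is holomorphic on any open `Ω` on which `F`, `G` are holomorphic and the
principal-branch condition `0 < Re(Σᵢ(Fᵢ(z) − Fᵢ(ζ))² + κ·G(ζ))` holds (`differentiableOn_kernel_source`); `F′` is holomorphic because `F` is
(`AnalyticOnNhd.deriv`).  Also recorded: holomorphy is a local property (`differentiableOn_of_locally_eq`), used to pass from the local fixed-contour
representations to the globally defined continued field.
HONEST FRAMING: a brick for a plan about a HYPOTHETICAL filament skeleton on the NEGATIVE side of a MODEL route; the stub `stub_stripPropagation` is NOT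
closed; nothing here bears on Navier–Stokes regularity or blow-up.  `--supports stmt-NavierStokesRegularity-23320`.
-/

set_option linter.dupNamespace false

noncomputable section

namespace Summit.NavierStokesRegularity.NavierStokesRegularity.Theorems.StadiumSourceHolomorphic

open Set Filter Topology Complex
open scoped Matrix

/-- **The kernel is holomorphic in the source variable.**  See the module docstring. [folklore] -/
theorem differentiableOn_kernel_source {Ω : Set ℂ} (hΩ : IsOpen Ω) {F : ℂ → (Fin 3 → ℂ)} {G : ℂ → ℂ}
    (hF : DifferentiableOn ℂ F Ω) (hG : DifferentiableOn ℂ G Ω) {κ : ℝ} (z : ℂ)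
    (hpos : ∀ ζ ∈ Ω, 0 < ((∑ i, (F z i - F ζ i) ^ 2) + (κ : ℂ) * G ζ).re) :
    DifferentiableOn ℂ (fun ζ => (((∑ i, (F z i - F ζ i) ^ 2) + (κ : ℂ) * G ζ) ^ ((3:ℂ) / 2))⁻¹ •
      (deriv F ζ ⨯₃ (fun i => F z i - F ζ i))) Ω := by
  have hdF : DifferentiableOn ℂ (deriv F) Ω := ((hF.analyticOnNhd hΩ).deriv).differentiableOn
  have hFi : ∀ i, DifferentiableOn ℂ (fun ζ => F z i - F ζ i) Ω := fun i =>
    (differentiableOn_const _).sub (differentiableOn_pi.1 hF i)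
  have hWd : DifferentiableOn ℂ (fun ζ => (∑ i, (F z i - F ζ i) ^ 2) + (κ : ℂ) * G ζ) Ω :=
    (DifferentiableOn.fun_sum fun i _ => (hFi i).pow 2).add (hG.const_mul _)
  have hpow : DifferentiableOn ℂ (fun ζ => (((∑ i, (F z i - F ζ i) ^ 2) + (κ : ℂ) * G ζ) ^ ((3:ℂ) / 2))⁻¹) Ω := by
    intro ζ hζ
    exact DifferentiableAt.comp_differentiableWithinAt (g := fun w : ℂ => (w ^ ((3:ℂ) / 2))⁻¹)
      (f := fun ζ => (∑ i, (F z i - F ζ i) ^ 2) + (κ : ℂ) * G ζ) ζ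
      (Summit.NavierStokesRegularity.NavierStokesRegularity.Theorems.StadiumKernelPieces.differentiableAt_inv_cpow_threeHalves (hpos ζ hζ))
      (hWd ζ hζ)
  have hdi : ∀ i, DifferentiableOn ℂ (fun ζ => deriv F ζ i) Ω := fun i => differentiableOn_pi.1 hdF i
  have hNd : DifferentiableOn ℂ (fun ζ => deriv F ζ ⨯₃ (fun i => F z i - F ζ i)) Ω := by
    refine differentiableOn_pi.2 fun i => ?_
    fin_cases i
    · simpa [cross_apply, Pi.mul_def, Pi.sub_def] using ((hdi 1).mul (hFi 2)).sub ((hdi 2).mul (hFi 1))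
    · simpa [cross_apply, Pi.mul_def, Pi.sub_def] using ((hdi 2).mul (hFi 0)).sub ((hdi 0).mul (hFi 2))
    · simpa [cross_apply, Pi.mul_def, Pi.sub_def] using ((hdi 0).mul (hFi 1)).sub ((hdi 1).mul (hFi 0))
  exact hpow.smul hNd

/-- **Holomorphy is local**: if near every point of an open `V` the function `U` agrees with some function holomorphic on a neighbourhood, then
`U` is holomorphic on `V`. [folklore] -/
theorem differentiableOn_of_locally_eq {E : Type*} [NormedAddCommGroup E] [NormedSpace ℂ E] {V : Set ℂ} {U : ℂ → E}
    (h : ∀ z₀ ∈ V, ∃ N ∈ 𝓝 z₀, ∃ U₀ : ℂ → E, DifferentiableAt ℂ U₀ z₀ ∧ ∀ z ∈ N, U z = U₀ z) :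
    DifferentiableOn ℂ U V := by
  intro z₀ hz₀
  obtain ⟨N, hN, U₀, hU₀, hEq⟩ := h z₀ hz₀
  have hev : U =ᶠ[𝓝 z₀] U₀ := Filter.eventually_of_mem hN fun z hz => hEq z hz
  exact (hU₀.congr_of_eventuallyEq hev).differentiableWithinAt

end Summit.NavierStokesRegularity.NavierStokesRegularity.Theorems.StadiumSourceHolomorphic

end
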